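import Literature.AlgebraicGeometry.VanGeemen1994.WeilTypeHodgeGroupSU
import Literature.AlgebraicGeometry.HodgeTheory.WeilTypeAbelianVariety
import Literature.AlgebraicGeometry.HodgeTheory.HodgeStructureOfHodgeModel
import Literature.AlgebraicGeometry.Motives.HodgeStructureK3Type
import HarnessLib

/-!
# Sub-Hodge structures of K3 type in `H²(B, ℚ)` of an abelian variety of Weil type: Lombardo's `S = ⋀²_K H¹ ⊂ H²` (type `(2,8,2)`; simple off the trivial discriminant; `S ≅ T ⊕ T` with `T` of K3 type `(1,4,1)` at discriminant one) and van Geemen–Rapagnetta's «no Hodge structure of K3 type in `H²(B, ℚ)` for general `B` of dimension `2n ≥ 6`» (Lombardo 2001 §3; van Geemen–Rapagnetta 2026 §1)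

[topic AlgebraicGeometry/HodgeTheory]

Layer `Literature/AlgebraicGeometry/HodgeTheory`; cross-ladder literature-typing layer (D-0088(4), LT-H4,
seat `hodge-lit-oqh-1` gen 3). The PRINTED OBSTRUCTION to an «`H²`-pull-back transfer lens» for abelian
SIXFOLDS of Weil type (ladder HodgeAV, rung H2): every hyperkähler/K3 proof for discriminant-one Weil
FOURFOLDS (Markman 2023, Floccari–Fu 2025, van Geemen–Rapagnetta 2026) pulls a K3-type Hodge structure into
`H²(B, ℚ)`; for general `B` of dimension `2n ≥ 6` no such sub-Hodge structure exists. HONEST FRAMING: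
typed ≠ proved ≠ endorsed; nothing here asserts HC / HC_AV / W₆. Two definitions with bodies, FOUR named
facts (statement only, D-0014; grade word per declaration), proved kernel; no Summit-side statement.

## Sources (read at source; locators = files of the materialised texts)

* [Lombardo2001] G. Lombardo, *Abelian varieties of Weil type and Kuga–Satake varieties*, Tohoku Math. J.
  53 (2001) 453–466 — **REFEREED**; held as the arXiv source `paper:arxiv-math_0211224` (§3 numbering as
  cited by [vanGeemenRapagnetta2026WeilHK]: Cor. 3.6, Thm. 3.8). Verbatim: §1 [p0003:L28–L29]
  "`a = discr(X,K,E) = (-1)ⁿ det(H) ∈ ℚ^*/Nm_{K/ℚ}(K^*)`" (`H = diag(a, 1, …, 1, -1, …, -1)`, `a > 0`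
  rational); Prop. 3.1 [p0005:L17] "`i : ⋀²_K V ↪ ⋀²_ℚ V` […] is injective and `Im(i) = {w ∈ ⋀²_ℚ V ;
  φ₂ w = -dw}`" (`φ₂(v ∧ w) = φv ∧ φw`); Lemma [p0005:L128–L165] "we study the sub-Hodge structures of the
  second cohomology group of a generic abelian fourfold of Weil type […] `S = i(⋀²_K H¹(X, ℚ)) ⊂ H²(X, ℚ)`
  […] Let `(X, K, E)` be an abelian fourfold of Weil type. Then the subspace `S` is a sub-Hodge structure
  of `H²(X, ℚ)` with `dim S^{2,0} = dim S^{0,2} = 2`, `dim S^{1,1} = 8`" (proof: "`S = H²₋`", the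
  `-d`-eigenspace of `φ₂`; "`dim S^{2,0} = dim ⋀²_ℂV₊^{1,0} + dim ⋀²_ℂV₋^{1,0}`,
  `dim S^{1,1} = dim V₊^{1,0}⊗V₊^{0,1} + dim V₋^{1,0}⊗V₋^{0,1}`", `dim V_±^{i,j} = 2` "since `X` is of
  Weil type `(2,2)`"); Cor. 3.6 [p0006:L74–L77] "`End_Hod(S) ≅ 𝐇`, where `𝐇 = {λ₁ + λ₂φ + λ₃t + λ₄φ∘t ;
  φ² = -d, t² = a, φ∘t = -t∘φ}` is a quaternion algebra over `ℚ`. In particular, if `a ∉ Nm_{K/ℚ}(K^*)`,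
  then `𝐇` is a skew field and hence `S` is a simple Hodge structure" (proof, L95: "`MT(ℂ) ≅ SL(4, ℂ)`
  […] holds for a general polarized Abelian variety of Weil type" — GENERICITY); Thm. 3.8 [p0006:L109–L115]
  "Let `(X, K, E)` be an abelian fourfold of Weil type with discriminant one. Then we have: 1. `S ≅ T₊ ⊕
  T₋`, where `T_± = Ker(t ± Id)` are sub-Hodge structures. 2. `φ : T₊ ⥲ T₋` is an isomorphism of Hodge
  structures. 3. […] `H̃|_{T×T} = Hyp ⊕ Hyp ⊕ [-2] ⊕ [-2d]`" and its Corollary [p0007:L25–L31] "The Hodge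
  structure `T` of 3.8.3 has type `(1,4,1)`" — NO genericity in Thm. 3.8.
* [vanGeemenRapagnetta2026WeilHK] B. van Geemen, A. Rapagnetta, *Hyperkähler sixfolds, abelian fourfolds
  of Weil type and a Hodge class*, arXiv:2607.18341 (July 2026) — **PREPRINT**; held
  `paper:arxiv-2607.18341`. Verbatim: Lemma 1.5, end of proof [p0007:L35–L40] "the discriminant of `H` is
  `(-1)ⁿ` if and only if there exists an `n`-dimensional `K`-subspace `W ⊂ V` such that `H|_{W×W} = 0`"
  — the dictionary «Lombardo's `a = 1`» = «hyperbolic» = the tree's `Motives.IsHyperbolicWeilType` /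
  `HodgeTheory.IsSplitWeilType` (van Geemen 1994 Lemma 5.2 (3), (5.4.1)), «non-trivial discriminant» = NOT
  hyperbolic; Thm. 1.8 (Lombardo) [p0009:L37–p0010:L19] "Let `(B, K)` be a very general abelian fourfold
  of Weil type with discriminant `a` […] a) `H²(B, ℚ) = H²(B, ℚ)₀ ⊕ T`, `dim H²(B, ℚ)₀ = 16`, `dim T = 12`,
  where the eigenvalues of `x ∈ K` on `H²(B, ℚ)₀` are `x x̄` and they are `x², x̄²` on `T`. b) […] This sub
  Hodge structure is a direct sum of `ℚω` […] and a simple 15-dimensional complement. c) `dim T^{2,0} =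
  2` […] `End_Hod(T)` […] is a skew field except if the discriminant `a` of `(B, K)` is one […] d) In case
  the discriminant `a = 1`, there exists a K3 type Hodge structure `T₁` such that `T ≅ T₁^{⊕2}`,
  `dim T₁^{2,0} = 1`, `dim T₁^{1,1} = 4`"; §1.9 [p0010:L39–L41] K3 type = "`V_ℂ = V^{2,0} ⊕ V^{1,1} ⊕
  V^{0,2}` […] `dim V^{2,0} = 1`" (the tree's `Motives.HodgeStructure.IsOfK3Type`, Huybrechts Def. 3.2.3);
  §1.14 [p0013:L16–L18] (`B` general, discriminant one) "the only sub Hodge structures of K3 type in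
  `H²(B, ℚ)` lie in `T`"; **§1.15 "Generalizations"** [p0013:L34–L50] "In case the discriminant of a
  general abelian fourfold of Weil type `B` is non-trivial, there is no sub Hodge structure of K3 type in
  `H²(B, ℚ)`, see Theorem 1.8, hence in this case there cannot exist such a map to a hyperkähler manifold.
  A general abelian variety `B` of Weil type of dimension `2n` for `n > 2` does not have Hodge structures of
  K3 type in `H²(B, ℚ)`, so it is not clear how to generalize the results from this paper. In fact, the
  Special Mumford-Tate group of `B` over `ℂ` is `SL(2n)` and the representation on `H¹(B, ℂ)` is the direct
  sum of the standard representation and its dual. This implies that there are three simple sub Hodge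
  structures in `H²(B, ℚ)`, these have `h^{2,0} = 2·C(n,2), n², 0` respectively. It is maybe interesting
  to observe that if the discriminant of `B` is trivial, then `Hⁿ(B, ℚ)` does have a sub Hodge structure
  `T₁` of CY type, so with `T₁^{n,0} = 1`, see [CF] for the case `n = 3`" ([CF] = Cacciatori–Filippini,
  *The E³/ℤ₃ orbifold, mirror symmetry, and Hodge structures of Calabi–Yau type*); proof of Lemma 1.6
  [p0009:L10–L16] "`H²(B, ℂ) = ∧²(ℂ⁴) ⊕ ∧²(ℂ⁴)^∨ ⊕ ℂ⁴ ⊗ (ℂ⁴)^∨`. The first two summands are irreducible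
  […] the last summand is `End(ℂ⁴) = ℂ id ⊕ sl(4)`" (the shape of the three-summand decomposition).
* Mechanism «special Mumford–Tate group of the general member `= SU_H`, `H¹_ℂ = W ⊕ W^*`»: van Geemen, LNM
  1594 (1994) Lemma 6.10, Thm. 6.11, typed as `VanGeemen1994.HasHodgeGroupSU` [vanGeemen1994HodgeAV].

## Carriers (pre-existing, BY NAME) and the two definitions here

`A : Motives.AbelianVariety ℂ`, `φ : A ⟶ A` with `φ ≫ φ = -d` (`HodgeTheory.IsWeilType A φ n d`), a
projective embedding `e`, a rational `a ≠ 0` on `ℙᴺ`, the `K`-symmetrised class `h_K = d·e^*a + φ^*e^*a`;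
«general» = `VanGeemen1994.HasHodgeGroupSU A φ n d h_K` (the genericity binder of `VanGeemen1994_thm612`,
`Abdulali1999_hodgeClasses_algebraic_powSucc_of_hasHodgeGroupSU`); «discriminant one» =
`Motives.IsHyperbolicWeilType A φ n h_K`; `H²(B, ℚ)` = `abelianBettiTwoHodgeStructure A M hM` (THIS FILE:
`HodgeModel.hodgeStructure` of a Hodge-symmetric model `M : HodgeModel A.dim A.X` in degree `2`, weight cast
to the literal `2` — the abelian-variety spelling of `HodgeTheory.bettiTwoHodgeStructure` /
`Hyperkaehler.bettiTwoHodgeStructureOfModel`); sub-Hodge structures / simple / K3 type / Hodge numbers =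
`Motives.HodgeStructure.SubHodgeStructure`, `.IsIrreducible`, `.IsOfK3Type`, `.hodgeNumber`; `φ₂` =
`Motives.bettiCohomology.map φ 2`; `S = {w ; φ₂ w = -d w}` = `weilExteriorSquare A φ d` (THIS FILE).
Statements quantify over every Hodge-symmetric model (tree idiom; `HodgeTheory.hodgePQ_independent_of_hodgeModel`).

## What is typed (grade per declaration in its docstring; sheet `FAITHFULNESS.md` §File 4 of the seat)

`Lombardo2001_weilExteriorSquare_subHodgeStructure` (Prop. 3.1 + Lemma, EVERY Weil-type `(A, φ)`: `S` is a
sub-Hodge structure, `h^{2,0} = 2·C(n,2)`, `h^{1,1} = 2n²` — REFEREED at `n = 2` / PRINT-SYNTHESIS for general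
`n`); `Lombardo2001_weilExteriorSquare_isIrreducible_of_not_hyperbolic` (Cor. 3.6 — REFEREED);
`Lombardo2001_weilExteriorSquare_K3Type_decomposition_of_hyperbolic` (Thm. 3.8 (1)(2) + Cor. — REFEREED;
item (3) not typed); `VanGeemenRapagnetta2026_K3Type_subHodgeStructures_generalWeilType` (§1.15 + Thm. 1.8 +
§1.14 — PREPRINT; clause (iii) with «irreducible» added, a located imprecision). Kernel (PROVED):
`….noK3Type_sixfold` (rung H2 spelling), `….exists_isOfK3Type` (the fourfold anchor), `S` is never of K3
type, arithmetic of the printed numbers.  NOT here: the §1.15 «opening» (`Hⁿ(B, ℚ) ⊃ T₁` of CY type at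
trivial discriminant, [CF] for `n = 3` — a remark without proof for general `n`; recorded for the lens
seats); Thm. 1.8 (b) beyond its use; uniqueness of `T₁`; the quaternion algebra `𝐇`; Thm. 3.8 (3);
[Lombardo2001] §§4–6; any algebraicity. TODO(general form): the `n ≥ 3` summands identified (`S`,
trace-free part of the `+d`-eigenspace, `ℚh_K`) once `⋀²(W ⊕ W^*)` is decomposed on the carriers.

## References

[Lombardo2001] Tohoku Math. J. 53 (2001): §1, §3 Prop. 3.1, Lemma (2,8,2), Cor. 3.6, Thm. 3.8 + Cor.;
[vanGeemenRapagnetta2026WeilHK] arXiv:2607.18341: Lemma 1.5–1.6, Thm. 1.8, §1.9, §1.14, §1.15;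
[vanGeemen1994HodgeAV] LNM 1594: Lemma 5.2 (3), (5.4.1), 6.10, 6.11; [Huybrechts2016K3] Def. 3.2.3.
-/

noncomputable section

open CategoryTheory
open scoped TensorProduct

namespace Literature.AlgebraicGeometry.HodgeTheory

open Literature.AlgebraicTopology.SingularHomology
open Literature.AlgebraicGeometry.Motives (AbelianVariety ProjectiveEmbedding projectiveSpace
  bettiCohomology HodgeStructure IsHyperbolicWeilType)
open Literature.AlgebraicGeometry.Motives.HodgeStructure (SubHodgeStructure)
open Literature.AlgebraicGeometry.VanGeemen1994 (HasHodgeGroupSU)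

section HodgeTheory

/-! ### The two carriers of this file: `H²_B(A)` in weight `2`, and Lombardo's `S = ⋀²_K H¹ ⊂ H²` -/

/-- **`H²(A(ℂ); ℚ)` with its weight-two `ℚ`-Hodge structure**, read through a Hodge-symmetric Hodge
model `M : HodgeModel A.dim A.X` of the abelian variety `A` (`HodgeModel.hodgeStructure` in degree `2`,
witness `Motives.AbelianVariety.isSmoothProjective_holds`), weight `((2 : ℕ) : ℤ)` cast to the literal
`2` — the abelian-variety spelling of `HodgeTheory.bettiTwoHodgeStructure`.
[cite: VoisinHodgeI2002, §7.1.1] [cite: vanGeemenRapagnetta2026WeilHK, §1.7–1.8] -/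
abbrev abelianBettiTwoHodgeStructure (A : AbelianVariety ℂ) (M : HodgeModel A.dim A.X)
    (hM : M.IsHodgeSymmetric) : HodgeStructure (bettiCohomology A.X 2) 2 :=
  (M.hodgeStructure Motives.AbelianVariety.isSmoothProjective_holds hM 2).cast rfl

/-- **Lombardo's `S = i(⋀²_K H¹(A, ℚ)) = {w ∈ H²(A, ℚ) ; φ₂ w = -d·w}`** (Prop. 3.1: the image of
`⋀²_K H¹ ↪ ⋀²_ℚ H¹ = H²` IS the `(-d)`-eigenspace of `φ₂(v ∧ w) = φv ∧ φw`; van Geemen–Rapagnetta Thm.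
1.8 (a): the summand `T` on which `x ∈ K` acts by `x²`), on `H²(A(ℂ); ℚ) = Motives.bettiCohomology A.X 2`
with `φ₂ = Motives.bettiCohomology.map φ 2` (Betti pull-back, a ring endomorphism of `H^*`).  Of
`ℚ`-dimension `2·C(2n, 2)` for `A` of Weil type `(n, d)` (`12` for fourfolds, `30` for sixfolds).
[cite: Lombardo2001, §3 Prop. 3.1 and Lemma (S = H²₋)] [cite: vanGeemenRapagnetta2026WeilHK, Thm. 1.8 (a)] -/
def weilExteriorSquare (A : AbelianVariety ℂ) (φ : A ⟶ A) (d : ℕ) :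
    Submodule ℚ (bettiCohomology A.X 2) :=
  Module.End.eigenspace (bettiCohomology.map φ.hom.hom.hom 2).hom (-(d : ℚ))

/-- Membership in `S`: `φ₂ w = -d·w`. [cite: Lombardo2001, §3 Prop. 3.1] -/
theorem mem_weilExteriorSquare_iff {A : AbelianVariety ℂ} {φ : A ⟶ A} {d : ℕ}
    {w : bettiCohomology A.X 2} :
    w ∈ weilExteriorSquare A φ d ↔ (bettiCohomology.map φ.hom.hom.hom 2).hom w = -((d : ℚ) • w) := by
  rw [weilExteriorSquare, Module.End.mem_eigenspace_iff, neg_smul]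

/-! ### Lombardo 2001, §3 — named facts -/

/-- **Lombardo 2001, Prop. 3.1 with the Lemma «`S` is a sub-Hodge structure of `H²(X, ℚ)` of type
`(2, 8, 2)`»** — for EVERY `(A, φ)` of Weil type `(n, d)` (no genericity, any discriminant): `S`
underlies a sub-Hodge structure of `H²(A, ℚ)` ("`S = H²₋`, and hence it is a sub-Hodge structure") with
`h^{2,0} = h^{0,2} = dim ⋀²V₊^{1,0} + dim ⋀²V₋^{1,0} = 2·C(n, 2)` and `h^{1,1} = dim V₊^{1,0}⊗V₊^{0,1} +
dim V₋^{1,0}⊗V₋^{0,1} = 2n²` (`dim V_±^{1,0} = dim V_±^{0,1} = n`, the Weil-type condition).  GRADE: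
`n = 2` (type `(2,8,2)` verbatim) REFEREED; general `n` PRINT-SYNTHESIS (Lombardo's displayed count, the
value `2·C(n,2)` printed in van Geemen–Rapagnetta §1.15, the tree's general theorem
`Motives.HodgeStructure.EndAction.hodgeNumber_weilPowerSub_eq_sum`).
[cite: Lombardo2001, §3 Prop. 3.1 and Lemma (type (2,8,2)) with its proof (arXiv source p0005:L128–L165)]
[cite: vanGeemenRapagnetta2026WeilHK, §1.15 and Thm. 1.8 (a), (c)] -/
def Lombardo2001_weilExteriorSquare_subHodgeStructure : Prop :=
  ∀ (A : AbelianVariety ℂ) (φ : A ⟶ A) (n d : ℕ), IsWeilType A φ n d →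
    ∀ (M : HodgeModel A.dim A.X) (hM : M.IsHodgeSymmetric),
      ∃ S : SubHodgeStructure (abelianBettiTwoHodgeStructure A M hM),
        S.toSubmodule = weilExteriorSquare A φ d ∧
          S.toHodgeStructure.hodgeNumber 2 0 = 2 * n.choose 2 ∧
            S.toHodgeStructure.hodgeNumber 1 1 = 2 * n ^ 2 ∧
              S.toHodgeStructure.hodgeNumber 0 2 = 2 * n.choose 2

/-- **Lombardo 2001, Cor. 3.6: for a GENERAL abelian fourfold of Weil type whose discriminant is not a
norm, `S` is a simple Hodge structure** ("if `a ∉ Nm_{K/ℚ}(K^*)`, then `𝐇` is a skew field and hence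
`S` is a simple Hodge structure"; proof via "`MT(ℂ) ≅ SL(4, ℂ)` […] for a general polarized Abelian
variety of Weil type"; = van Geemen–Rapagnetta Thm. 1.8 (c)).  Rendering: `(A, φ)` of Weil type `(2, d)`,
`h_K = d·e^*a + φ^*e^*a` with special Mumford–Tate group `SU_H` (`HasHodgeGroupSU`) and NOT hyperbolic
(`a = (-1)² det H ≠ 1`) ⟹ every sub-Hodge structure of `H²(A, ℚ)` with underlying space `S` is
irreducible (`IsIrreducible`).  The quaternion algebra `𝐇` is not typed.  GRADE: REFEREED.
[cite: Lombardo2001, §3 Cor. 3.6 with its proof (arXiv source p0006:L74–L101)]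
[cite: vanGeemenRapagnetta2026WeilHK, Thm. 1.8 (c) and Lemma 1.5 (last paragraph of the proof)]
[cite: vanGeemen1994HodgeAV, Lemma 5.2 (3) and Thm. 6.11] -/
def Lombardo2001_weilExteriorSquare_isIrreducible_of_not_hyperbolic : Prop :=
  ∀ (A : AbelianVariety ℂ) (φ : A ⟶ A) (d : ℕ) (e : ProjectiveEmbedding A.X)
    (a : complexBetti (projectiveSpace e.n ℂ) 2),
    IsWeilType A φ 2 d → IsRationalClass a → a ≠ 0 →
    HasHodgeGroupSU A φ 2 d
      ((d : ℂ) • complexBetti.map e.ι 2 a + complexBetti.map φ.hom.hom.hom 2 (complexBetti.map e.ι 2 a)) →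
    ¬ IsHyperbolicWeilType A φ 2
      ((d : ℂ) • complexBetti.map e.ι 2 a + complexBetti.map φ.hom.hom.hom 2 (complexBetti.map e.ι 2 a)) →
    ∀ (M : HodgeModel A.dim A.X) (hM : M.IsHodgeSymmetric)
      (S : SubHodgeStructure (abelianBettiTwoHodgeStructure A M hM)),
      S.toSubmodule = weilExteriorSquare A φ d → S.toHodgeStructure.IsIrreducible

/-- **Lombardo 2001, Thm. 3.8 (1)–(2) with its Corollary: on an abelian fourfold of Weil type with
discriminant one, `S ≅ T₊ ⊕ T₋` with `T_±` sub-Hodge structures OF K3 TYPE `(1, 4, 1)`, `T₊ ≅ T₋`**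
(= van Geemen–Rapagnetta Thm. 1.8 (d); Lombardo's Introduction: "there exists a polarized sub-Hodge
structure of the second cohomology group of dimension `6` with `h^{2,0} = 1`").  NO genericity
hypothesis.  Rendering: `(A, φ)` of Weil type `(2, d)`, `h_K` hyperbolic (`(-1)² det H = 1`) ⟹ for
every Hodge-symmetric model there are sub-Hodge structures `T₊, T₋` of `H²(A, ℚ)` with `T₊ ∩ T₋ = 0`,
`T₊ + T₋ = S`, both of K3 type (`IsOfK3Type`) with `h^{1,1} = 4`, and a bijective morphism of Hodge
structures `T₊ → T₋` (the printed isomorphism is the `K`-scalar action of `φ` on `⋀²_K H¹`, i.e.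
`v ∧ w ↦ ½(φv ∧ w + v ∧ φw)` — NOT `φ₂`, the scalar `-d` on `S`; only its existence is typed).  Item (3)
(the form `Hyp ⊕ Hyp ⊕ [-2] ⊕ [-2d]` on `T`) is NOT typed.  GRADE: REFEREED.
[cite: Lombardo2001, §3 Thm. 3.8 (1)–(2) and the Corollary «T has type (1,4,1)» (arXiv source p0006:L109–L115, p0007:L25–L31); Introduction]
[cite: vanGeemenRapagnetta2026WeilHK, Thm. 1.8 (d) and Lemma 1.5]
[cite: vanGeemen1994HodgeAV, Lemma 5.2 (3) and 5.4 (5.4.1)] -/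
def Lombardo2001_weilExteriorSquare_K3Type_decomposition_of_hyperbolic : Prop :=
  ∀ (A : AbelianVariety ℂ) (φ : A ⟶ A) (d : ℕ) (e : ProjectiveEmbedding A.X)
    (a : complexBetti (projectiveSpace e.n ℂ) 2),
    IsWeilType A φ 2 d → IsRationalClass a → a ≠ 0 →
    IsHyperbolicWeilType A φ 2
      ((d : ℂ) • complexBetti.map e.ι 2 a + complexBetti.map φ.hom.hom.hom 2 (complexBetti.map e.ι 2 a)) →
    ∀ (M : HodgeModel A.dim A.X) (hM : M.IsHodgeSymmetric),
      ∃ Tp Tm : SubHodgeStructure (abelianBettiTwoHodgeStructure A M hM),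
        Tp.toSubmodule ⊓ Tm.toSubmodule = ⊥ ∧
          Tp.toSubmodule ⊔ Tm.toSubmodule = weilExteriorSquare A φ d ∧
            Tp.toHodgeStructure.IsOfK3Type ∧ Tm.toHodgeStructure.IsOfK3Type ∧
              Tp.toHodgeStructure.hodgeNumber 1 1 = 4 ∧ Tm.toHodgeStructure.hodgeNumber 1 1 = 4 ∧
                ∃ f : HodgeStructure.Hom Tp.toHodgeStructure Tm.toHodgeStructure,
                  Function.Bijective f.toLinearMap

/-! ### van Geemen–Rapagnetta 2026, §1.15 with Thm. 1.8 and §1.14 — named fact (PREPRINT) -/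

/-- **van Geemen–Rapagnetta 2026, §1.15 "Generalizations" (with Thm. 1.8 and §1.14): where the
sub-Hodge structures of K3 type of `H²(B, ℚ)` are, for a GENERAL abelian variety `B` of Weil type**
("A general abelian variety `B` of Weil type of dimension `2n` for `n > 2` does not have Hodge structures
of K3 type in `H²(B, ℚ)` […] there are three simple sub Hodge structures in `H²(B, ℚ)`, these have
`h^{2,0} = 2·C(n,2), n², 0`"; "In case the discriminant of a general abelian fourfold […] is non-trivial,
there is no sub Hodge structure of K3 type in `H²(B, ℚ)`"; §1.14 "the only sub Hodge structures of K3
type in `H²(B, ℚ)` lie in `T`").  Rendering, for `(A, φ)` of Weil type `(n, d)` and `h_K = d·e^*a +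
φ^*e^*a` with special Mumford–Tate group `SU_H` (`HasHodgeGroupSU`, «general»), every Hodge-symmetric
model: (i) `3 ≤ n` ⟹ NO sub-Hodge structure of `H²(A, ℚ)` is of K3 type, AND `H²(A, ℚ) = S₁ ⊕ S₂ ⊕ S₃`
with `Sᵢ` irreducible sub-Hodge structures, `h^{2,0} = 2·C(n,2)`, `n²`, `0` (the decomposition of
`⋀²(W ⊕ W^*)` printed in the proof of Lemma 1.6 for `n = 2`); (ii) `n = 2`, `h_K` NOT hyperbolic ⟹ no
sub-Hodge structure of K3 type; (iii) `n = 2`, `h_K` hyperbolic ⟹ every IRREDUCIBLE sub-Hodge structure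
of K3 type lies in `S = weilExteriorSquare A φ d` (Thm. 1.8's `T`) — LOCATED imprecision: the printed
sentence omits «irreducible» (it is applied to the irreducible `T_{X,ℚ}`); read literally with Def. 1.9
it fails for `T₁ ⊕ ℚω` (`h^{2,0} = 1`, `ω ∉ T`), so the clause carries the hypothesis its printed use
has.  GRADE: PREPRINT (arXiv, July 2026); mechanism classical and refereed (van Geemen 1994 Lemma 6.10 /
Thm. 6.11; Lombardo 2001 for `n = 2`); the `n > 2` sentence is printed with the representation-theoretic
reason only.  The printed obstruction to transferring the fourfold `H²`-pull-back mechanism (a K3-type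
`T_X ↪ H²(B, ℚ)`) to Weil SIXFOLDS; nothing about algebraicity is asserted.
[cite: vanGeemenRapagnetta2026WeilHK, §1.15 (arXiv p. 13, L34–L50), Thm. 1.8 (a)–(d), §1.14 (p. 13, L16–L18)]
[cite: Lombardo2001, §3 Cor. 3.6 and Thm. 3.8] [cite: vanGeemen1994HodgeAV, Lemma 6.10 and Thm. 6.11] -/
def VanGeemenRapagnetta2026_K3Type_subHodgeStructures_generalWeilType : Prop :=
  ∀ (A : AbelianVariety ℂ) (φ : A ⟶ A) (n d : ℕ) (e : ProjectiveEmbedding A.X)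
    (a : complexBetti (projectiveSpace e.n ℂ) 2),
    IsWeilType A φ n d → IsRationalClass a → a ≠ 0 →
    HasHodgeGroupSU A φ n d
      ((d : ℂ) • complexBetti.map e.ι 2 a + complexBetti.map φ.hom.hom.hom 2 (complexBetti.map e.ι 2 a)) →
    ∀ (M : HodgeModel A.dim A.X) (hM : M.IsHodgeSymmetric),
      (3 ≤ n →
        (∀ S : SubHodgeStructure (abelianBettiTwoHodgeStructure A M hM),
            ¬ S.toHodgeStructure.IsOfK3Type) ∧
          ∃ S₁ S₂ S₃ : SubHodgeStructure (abelianBettiTwoHodgeStructure A M hM),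
            iSupIndep ![S₁.toSubmodule, S₂.toSubmodule, S₃.toSubmodule] ∧
              S₁.toSubmodule ⊔ S₂.toSubmodule ⊔ S₃.toSubmodule = ⊤ ∧
                S₁.toHodgeStructure.IsIrreducible ∧ S₂.toHodgeStructure.IsIrreducible ∧
                  S₃.toHodgeStructure.IsIrreducible ∧
                    S₁.toHodgeStructure.hodgeNumber 2 0 = 2 * n.choose 2 ∧
                      S₂.toHodgeStructure.hodgeNumber 2 0 = n ^ 2 ∧
                        S₃.toHodgeStructure.hodgeNumber 2 0 = 0) ∧
      (n = 2 →
        ¬ IsHyperbolicWeilType A φ 2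
          ((d : ℂ) • complexBetti.map e.ι 2 a + complexBetti.map φ.hom.hom.hom 2 (complexBetti.map e.ι 2 a)) →
        ∀ S : SubHodgeStructure (abelianBettiTwoHodgeStructure A M hM),
          ¬ S.toHodgeStructure.IsOfK3Type) ∧
      (n = 2 →
        IsHyperbolicWeilType A φ 2
          ((d : ℂ) • complexBetti.map e.ι 2 a + complexBetti.map φ.hom.hom.hom 2 (complexBetti.map e.ι 2 a)) →
        ∀ S : SubHodgeStructure (abelianBettiTwoHodgeStructure A M hM),
          S.toHodgeStructure.IsIrreducible → S.toHodgeStructure.IsOfK3Type →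
            S.toSubmodule ≤ weilExteriorSquare A φ d)

/-! ### Kernel: the spellings the ladder cells use (PROVED from the facts) -/

variable {A : AbelianVariety ℂ} {φ : A ⟶ A} {n d : ℕ}

/-- **No Hodge structure of K3 type in `H²` of a general Weil-type abelian variety of dimension
`2n ≥ 6`** — clause (i), first half, of the van Geemen–Rapagnetta fact.
[cite: vanGeemenRapagnetta2026WeilHK, §1.15] -/
theorem VanGeemenRapagnetta2026_K3Type_subHodgeStructures_generalWeilType.noK3Type_of_three_le
    (h : VanGeemenRapagnetta2026_K3Type_subHodgeStructures_generalWeilType)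
    (e : ProjectiveEmbedding A.X) {a : complexBetti (projectiveSpace e.n ℂ) 2} (hn : 3 ≤ n)
    (hW : IsWeilType A φ n d) (ha : IsRationalClass a) (ha0 : a ≠ 0)
    (hSU : HasHodgeGroupSU A φ n d
      ((d : ℂ) • complexBetti.map e.ι 2 a + complexBetti.map φ.hom.hom.hom 2 (complexBetti.map e.ι 2 a)))
    (M : HodgeModel A.dim A.X) (hM : M.IsHodgeSymmetric)
    (S : SubHodgeStructure (abelianBettiTwoHodgeStructure A M hM)) :
    ¬ S.toHodgeStructure.IsOfK3Type :=
  ((h A φ n d e a hW ha ha0 hSU M hM).1 hn).1 S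

/-- **The SIXFOLD instance (ladder HodgeAV, rung H2): for a general abelian sixfold of Weil type
(`Hg = SU_H`), whatever `K = ℚ(√-d)` and the discriminant, `H²(A, ℚ)` contains no sub-Hodge structure of
K3 type** — no correspondence can embed a K3-type `T_X ⊂ H²(X, ℚ)` of a hyperkähler `X` into `H²(A, ℚ)`
("so it is not clear how to generalize the results from this paper"). [cite: vanGeemenRapagnetta2026WeilHK, §1.15] -/
theorem VanGeemenRapagnetta2026_K3Type_subHodgeStructures_generalWeilType.noK3Type_sixfold
    (h : VanGeemenRapagnetta2026_K3Type_subHodgeStructures_generalWeilType)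
    (e : ProjectiveEmbedding A.X) {a : complexBetti (projectiveSpace e.n ℂ) 2}
    (hW : IsWeilType A φ 3 d) (ha : IsRationalClass a) (ha0 : a ≠ 0)
    (hSU : HasHodgeGroupSU A φ 3 d
      ((d : ℂ) • complexBetti.map e.ι 2 a + complexBetti.map φ.hom.hom.hom 2 (complexBetti.map e.ι 2 a)))
    (M : HodgeModel A.dim A.X) (hM : M.IsHodgeSymmetric)
    (S : SubHodgeStructure (abelianBettiTwoHodgeStructure A M hM)) :
    ¬ S.toHodgeStructure.IsOfK3Type :=
  h.noK3Type_of_three_le e le_rfl hW ha ha0 hSU M hM S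

/-- **Non-trivial discriminant FOURFOLDS: no sub-Hodge structure of K3 type** — clause (ii).
[cite: vanGeemenRapagnetta2026WeilHK, §1.15 and Thm. 1.8] -/
theorem VanGeemenRapagnetta2026_K3Type_subHodgeStructures_generalWeilType.noK3Type_fourfold_of_not_hyperbolic
    (h : VanGeemenRapagnetta2026_K3Type_subHodgeStructures_generalWeilType)
    (e : ProjectiveEmbedding A.X) {a : complexBetti (projectiveSpace e.n ℂ) 2}
    (hW : IsWeilType A φ 2 d) (ha : IsRationalClass a) (ha0 : a ≠ 0)
    (hSU : HasHodgeGroupSU A φ 2 d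
      ((d : ℂ) • complexBetti.map e.ι 2 a + complexBetti.map φ.hom.hom.hom 2 (complexBetti.map e.ι 2 a)))
    (hnh : ¬ IsHyperbolicWeilType A φ 2
      ((d : ℂ) • complexBetti.map e.ι 2 a + complexBetti.map φ.hom.hom.hom 2 (complexBetti.map e.ι 2 a)))
    (M : HodgeModel A.dim A.X) (hM : M.IsHodgeSymmetric)
    (S : SubHodgeStructure (abelianBettiTwoHodgeStructure A M hM)) :
    ¬ S.toHodgeStructure.IsOfK3Type :=
  (h A φ 2 d e a hW ha ha0 hSU M hM).2.1 rfl hnh S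

/-- **Discriminant-one FOURFOLDS: every irreducible K3-type sub-Hodge structure of `H²(A, ℚ)` lies
in Lombardo's `S`** — clause (iii). [cite: vanGeemenRapagnetta2026WeilHK, §1.14 and Thm. 1.8 (d)] -/
theorem VanGeemenRapagnetta2026_K3Type_subHodgeStructures_generalWeilType.le_weilExteriorSquare_of_hyperbolic
    (h : VanGeemenRapagnetta2026_K3Type_subHodgeStructures_generalWeilType)
    (e : ProjectiveEmbedding A.X) {a : complexBetti (projectiveSpace e.n ℂ) 2}
    (hW : IsWeilType A φ 2 d) (ha : IsRationalClass a) (ha0 : a ≠ 0)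
    (hSU : HasHodgeGroupSU A φ 2 d
      ((d : ℂ) • complexBetti.map e.ι 2 a + complexBetti.map φ.hom.hom.hom 2 (complexBetti.map e.ι 2 a)))
    (hh : IsHyperbolicWeilType A φ 2
      ((d : ℂ) • complexBetti.map e.ι 2 a + complexBetti.map φ.hom.hom.hom 2 (complexBetti.map e.ι 2 a)))
    (M : HodgeModel A.dim A.X) (hM : M.IsHodgeSymmetric)
    {S : SubHodgeStructure (abelianBettiTwoHodgeStructure A M hM)}
    (hirr : S.toHodgeStructure.IsIrreducible) (hS : S.toHodgeStructure.IsOfK3Type) :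
    S.toSubmodule ≤ weilExteriorSquare A φ d :=
  (h A φ 2 d e a hW ha ha0 hSU M hM).2.2 rfl hh S hirr hS

/-- **The fourfold ANCHOR exists (Lombardo Thm. 3.8): on a discriminant-one abelian fourfold of Weil
type, `H²(A, ℚ)` DOES contain a sub-Hodge structure of K3 type** (inside `S`), for EVERY such `A`
(no genericity) — the starting point of the `H²`-pull-back mechanism for fourfolds.
[cite: Lombardo2001, §3 Thm. 3.8 and its Corollary] [cite: vanGeemenRapagnetta2026WeilHK, Thm. 1.8 (d)] -/
theorem Lombardo2001_weilExteriorSquare_K3Type_decomposition_of_hyperbolic.exists_isOfK3Type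
    (h : Lombardo2001_weilExteriorSquare_K3Type_decomposition_of_hyperbolic)
    (e : ProjectiveEmbedding A.X) {a : complexBetti (projectiveSpace e.n ℂ) 2}
    (hW : IsWeilType A φ 2 d) (ha : IsRationalClass a) (ha0 : a ≠ 0)
    (hh : IsHyperbolicWeilType A φ 2
      ((d : ℂ) • complexBetti.map e.ι 2 a + complexBetti.map φ.hom.hom.hom 2 (complexBetti.map e.ι 2 a)))
    (M : HodgeModel A.dim A.X) (hM : M.IsHodgeSymmetric) :
    ∃ T : SubHodgeStructure (abelianBettiTwoHodgeStructure A M hM),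
      T.toSubmodule ≤ weilExteriorSquare A φ d ∧ T.toHodgeStructure.IsOfK3Type ∧
        T.toHodgeStructure.hodgeNumber 1 1 = 4 := by
  obtain ⟨Tp, Tm, -, hsup, hp, -, hp11, -, -⟩ := h A φ d e a hW ha ha0 hh M hM
  exact ⟨Tp, hsup ▸ le_sup_left, hp, hp11⟩

/-- **Lombardo's `S` is not itself of K3 type** (its `h^{2,0}` is `2·C(n,2)`: `2` for fourfolds, `6`
for sixfolds — never `1`): from the first fact, for every Weil-type `(A, φ)` with `n ≥ 2`.
[cite: Lombardo2001, §3 Lemma (type (2,8,2))] [cite: vanGeemenRapagnetta2026WeilHK, §1.15] -/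
theorem Lombardo2001_weilExteriorSquare_subHodgeStructure.not_isOfK3Type
    (h : Lombardo2001_weilExteriorSquare_subHodgeStructure) (hn : 2 ≤ n) (hW : IsWeilType A φ n d)
    (M : HodgeModel A.dim A.X) (hM : M.IsHodgeSymmetric) :
    ∃ S : SubHodgeStructure (abelianBettiTwoHodgeStructure A M hM),
      S.toSubmodule = weilExteriorSquare A φ d ∧ ¬ S.toHodgeStructure.IsOfK3Type := by
  obtain ⟨S, hS, h20, -, -⟩ := h A φ n d hW M hM
  refine ⟨S, hS, fun hK3 ↦ ?_⟩
  have h1 := hK3.hodgeNumber_two_zero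
  rw [h20] at h1
  have : 2 ≤ 2 * n.choose 2 := by
    have : 1 ≤ n.choose 2 := Nat.succ_le_of_lt (Nat.choose_pos hn)
    omega
  omega

/-! ### Arithmetic of the printed Hodge numbers (why no summand is of K3 type; the sixfold numbers) -/

/-- For `n ≥ 2` neither printed value `2·C(n,2)` nor `n²` of `h^{2,0}` on the simple summands equals `1`
(the third is `0`): none of the three summands is of K3 type. [cite: vanGeemenRapagnetta2026WeilHK, §1.15] -/
theorem two_mul_choose_two_ne_one_and_sq_ne_one (hn : 2 ≤ n) : 2 * n.choose 2 ≠ 1 ∧ n ^ 2 ≠ 1 := by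
  refine ⟨fun h ↦ by omega, fun h ↦ ?_⟩
  have h4 : 2 ^ 2 ≤ n ^ 2 := Nat.pow_le_pow_left hn 2
  omega

/-- SIXFOLDS (`n = 3`): the summands have `h^{2,0} = 6, 9, 0` (total `C(6,2) = h^{2,0}(B)`) on pieces
of dimension `2·C(6,2) = 30` (`S`), `4·3² - 1 = 35`, `1`, total `b₂ = C(12,2)`; FOURFOLDS (Thm. 1.8):
`dim T = 2·C(4,2) = 12`, `dim H²(B, ℚ)₀ = 15 + 1`, total `C(8,2)`; `h^{2,0}`: `2 + 4 + 0 = C(4,2)`; at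
discriminant one `T ≅ T₁ ⊕ T₁`, `T₁` of type `(1,4,1)`: `2·(1+4+1) = 12`.
[cite: vanGeemenRapagnetta2026WeilHK, §1.15 and Thm. 1.8] [cite: Lombardo2001, §3 Prop. 3.1, Thm. 3.8] -/
example : (2 * Nat.choose 3 2 = 6 ∧ 3 ^ 2 = 9 ∧ 6 + 9 + 0 = Nat.choose 6 2 ∧
      2 * Nat.choose 6 2 = 30 ∧ 4 * 3 ^ 2 - 1 = 35 ∧ 30 + 35 + 1 = Nat.choose 12 2) ∧
    (2 * Nat.choose 4 2 = 12 ∧ 4 * 2 ^ 2 - 1 = 15 ∧ 12 + 15 + 1 = Nat.choose 8 2 ∧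
      2 * Nat.choose 2 2 + 2 ^ 2 + 0 = Nat.choose 4 2 ∧ 2 * (1 + 4 + 1) = 12) := by
  decide

end HodgeTheory

end Literature.AlgebraicGeometry.HodgeTheory

end
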